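import Summits.QuantumFields.YangMills.Theorems.BalabanUVNodesN22W1RelCentredSliceInputsLGWitness
import Literature.MathematicalPhysics.QuantumFieldTheory.Balaban1983to89.Node00.HistoryTermDatum214LocalGrowthAnalytic
import Literature.MathematicalPhysics.QuantumFieldTheory.Balaban1983to89.Node00.HistoryTermDatum214Inputs226

/-!
# BalabanUVNodes ∕ node N22 = NE9 — MODULE J88-W: THE LOCATED FAMILIES `hιc` OF THE SOCKETS OF RECORD (J89 ∕ J81s: LEMMA 2's SENTENCE edition; J88 ∕ J81r: local-growth edition)
# ARE INHABITED, JOINTLY WITH THE BOX LAWS `hBox ∕ hχ1` AND THE UNSCALED-FIELD LAW `hlaw`, AT node00-def-W1's DEGENERATE DATUM (free kernels on one row bond, ZERO complex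
# potentials, INDICATOR boxes `χᵘ = 𝟙[|P| = 0]`, `χᶜᵘ ≡ 1`) — the A6 witness standing rule №189 ∕ director-ym №193 ask of a located ∃-family (this lane's (t40))

Cell `pub-ymgap`, HUMAN RULING D-0062 (Track A), R134 seat `pub-ymgap-dag-n22-c` (strategy s1), generation 21, module J88-W.  THEOREMS ONLY (no `def`, no `sorry`, standard axioms);
`--kind proof --supports stmt-QuantumFields-27366 --as helper` (K3⁸), COUNT-NEUTRAL.  Imports this lane's g8 module J10-W `…N22W1RelCentredSliceInputsLGWitness` (the degenerate-datum technique,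
`exp_neg_posLog_le`, NODE A's `freeKernels`) and node00-def-W1's W1-12b `…HistoryTermDatum214LocalGrowthAnalytic` (`AnalyticGrowthInputs`, `LocalGrowthInputs.ofAnalytic`, through it W1-12's
`LocalGrowthInputs ∕ UnscaledBoxLaws` and W1-11's `UnscaledFieldLawOn`) ∕ W1-8 `…HistoryTermDatum214Inputs226` (`Inputs226Holo`).  Nothing re-declared.

WHY ∕ WHAT.  The sockets display per slice and base point ONE located family `hιc` (`∃ ι : Inputs226Holo …, ∃ ag : AnalyticGrowthInputs … ∕ lg : LocalGrowthInputs …, ∃ KE KG′ KCs′ θΓ′ θC′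
θE′ a_m w_m δ, rows (r1)–(r6)`) next to the slice-free `hBox`, `hχ1`, `hlaw`.  A located hypothesis family is only as honest as its joint inhabitability (g7 J9 VACUOUS at `|P| ≥ 1`, №193;
g9 J12-D's configuration-free leading parts).  THIS FILE exhibits, for EVERY `c` with W1-8's elementary conditions (`κ₁ ≥ 1`, positive `E₀ ε₁ C₁ α₄ M`, `(1 − 3δ)κ ≥ 0`,
`E₀ε₁C₁α₄⁻¹M^q e^{C₂κ₁} ≤ ½`), every window `γ`, weight letter `a`, `Mv > 1`, at `ρ_b = 1∕12`, `a₅ = 2`: ONE datum (`ν = 0`, free kernels `A ≡ 1, G ≡ 0, Γ₀ = 0, C = 1` on one row bond,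
`r = 1`, `𝒱 ≡ 0`, `χ_{Y₀}(s,B) := 𝟙[|P(t)| = 0]`, `χᶜ ≡ 1`) with readings `χᵘ := 𝟙[|P| = 0]`, `χᶜᵘ ≡ 1`, `𝒲 ≡ 𝒪 ≡ 0` such that `hlaw` (on `]0,γ]`), `hBox`, `hχ1` hold AND for every nonempty
`Z`, every `s, old, φ`, `t > 0` the family's body holds with: `ι` = J10-W's letters (`U_σ = univ`, `Uτ(Y) = ball 0 ((invTau c d(Y))⁻¹ + 3)`, `γ₂ = 1∕20`, `r_P² = 20·max(a,0) +
40·log⁺(1∕(Mv t²))`, `q_P = ⟨B,B⟩`, `a₂₀ = w = 0`, `κ = 3 > 2 > 1`, `θ = ⅕`, `θ_E = θ_Γ = θ_C = K_G = K_Γ = 0`, `K_{Cσ} = K₀ = c_E = 1`, `g = 0`); `ag` = the ZERO complex potentials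
(`R = 2`, `ρ = 1`, `M𝒲 = M𝒪 ≡ 0`, `BeginsAt 0 3`, empty supports, zero profile, τ-radii `(invTau c d(Y))⁻¹ + 3`); `K_E = 1`, primed letters at `ρ_b = 1∕12`, `a_m = 1∕20`, `w_m = 0`,
`δ = 1∕40`; (r5) on `|P(s)| = 0` the boxes ARE `1`, `κ_b = 1∕20`, `R_b² = 40·log⁺(1∕((Mv−1)t²))`, `T = Mv − 1`; (r6) on `|P(s)| ≠ 0` J10-W's `r₁² = 20·max(a,0)`, `T′ = Mv`.
* §1 ★ `locatedLemma2Records_inhabited` — J89 ∕ J81s's family (Lemma 2's sentence); §2 ★ `locatedRecords_inhabited` — J88 ∕ J81r's family, `lg := LocalGrowthInputs.ofAnalytic ag` (rows by `rfl`).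

HONEST FRAMING (binding).  An A6 CONSISTENCY witness at DEGENERATE data (free kernels, vanishing potentials — NOT Bałaban's objects): the located families, the box laws and the
unscaled-field law are JOINTLY satisfiable slice by slice with `t`-UNIFORM letters except the (r5)∕(r6) radii; it does NOT inhabit the bills' OTHER hypotheses (N18's rate, (1.21), W1-20's
law, NODE A's records at the datum OF RECORD, the reading laws, the chart, the capstone numerics) and does NOT claim the bills' antecedents jointly inhabited; `a₅ = 2`, `ρ_b = 1∕12` are
the witness's.  Nothing of Bałaban's asserted; N22 NOT discharged; K3⁸ untouched; counts unmoved; one finite 𝕋⁴ programme at fixed ε — NOTHING about the continuum, ℝ⁴, OS, a mass gap or Clay.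
References (TYPES only): [II] = Bałaban, CMP 116 (1988) (2.3) p. 12, (2.14) p. 15, (2.16)–(2.22) p. 16, (2.23)–(2.26) p. 17, Lemma 2 p. 11, (1.34) p. 9; [I] = CMP 109 (1987) (2.9)–(2.13) pp. 266–268.
-/

noncomputable section

namespace YMDAG.N22.W1

open Set Metric Matrix
open scoped BigOperators
open Literature.MathematicalPhysics.QuantumFieldTheory.Balaban1983to89
open Literature.MathematicalPhysics.QuantumFieldTheory.Balaban1983to89.TreeLengthTorus (TPt TDom tsys torusTreeLen torusTreeLen_nonneg)
open Literature.MathematicalPhysics.QuantumFieldTheory.Balaban1983to89.B13Bound143 (invTau invTau_pos)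
open Literature.MathematicalPhysics.QuantumFieldTheory.Balaban1983to89.B9Thm37GlueTorus (tdist1 tdist1_self)
open Literature.MathematicalPhysics.QuantumFieldTheory.Balaban1983to89.B5TorusCover (UT)
open Literature.MathematicalPhysics.QuantumFieldTheory.Balaban1983to89.B13TermWalkDataOneTorus (freeKernels)
open Literature.MathematicalPhysics.QuantumFieldTheory.Balaban1983to89.Node00.Sect2 (domSys domCount CPair)
open Literature.MathematicalPhysics.QuantumFieldTheory.Balaban1983to89.Node00.W1

variable (c : B13.Consts) (P : Params) (𝔸 : Type*) (M k L : ℕ) [NeZero L]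

/-! ## §1 ★ The located family of J89 ∕ J81s (LEMMA 2's SENTENCE edition) is inhabited jointly with the box laws and the unscaled-field law -/

open Classical in
/-- ★ **THE LOCATED FAMILY `hιc` OF J89 ∕ J81s (LEMMA 2's SENTENCE EDITION) IS INHABITED JOINTLY WITH `hlaw`, `hBox`, `hχ1`** at node00-def-W1's degenerate datum with INDICATOR boxes
(`χᵘ = 𝟙[|P| = 0]`, `χᶜᵘ ≡ 1`) and ZERO complex potentials: for every `c` with W1-8's elementary conditions, window `γ`, weight letter `a` and `Mv > 1`, at `ρ_b = 1∕12`, `a₅ = 2`, there are `𝔇 χᵘ χᶜᵘ 𝒲 𝒪` with `𝔇.UnscaledFieldLawOn χᵘ χᶜᵘ 𝒲 𝒪 γ`,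
`𝔇.UnscaledBoxLaws χᵘ χᶜᵘ Z s` and `χᵘχᶜᵘ ≤ 1` for all `(Z, s)`, and, for every nonempty `Z`, every `s, old, φ` and every base point `t > 0`, records `ι : 𝔇.Inputs226Holo c Z s ↑t old φ a 2`,
`ag : 𝔇.AnalyticGrowthInputs χᵘ 𝒲 𝒪 Z s old φ ι.Uτ` and reals `KE KG′ KCs′ θΓ′ θC′ θE′ a_m w_m δ` satisfying the rows (r1)–(r6) of J89's `hιc` VERBATIM (box block on `|P(s)| = 0`, surplus block
on `|P(s)| ≠ 0`).  A6 witness at degenerate data; nothing of print's. [cite: Balaban1988RG2Cluster, (2.3) p.12, (2.14) p.15 and (2.22) p.16 (degenerate data; bookkeeping)] -/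
theorem locatedLemma2Records_inhabited (hκ₁ : 1 ≤ c.κ₁) (hE : 0 < c.E₀) (hε : 0 < c.ε₁) (hC₁ : 0 < c.C₁) (hα : 0 < c.α₄) (hMc : 0 < c.M)
    (hδκ : 0 ≤ (1 - 3 * c.δ) * c.κ) (hpref : c.E₀ * c.ε₁ * c.C₁ * c.α₄⁻¹ * c.M ^ c.q * Real.exp (c.C₂ * c.κ₁) ≤ 1 / 2)
    (γ a : ℝ) {Mv : ℝ} (hMv : 1 < Mv) :
    ∃ (𝔇 : TermDatum214 c P 𝔸 M k L) (χu χcu : 𝔇.UnscaledChi) (𝒲 : 𝔇.UnscaledWilson) (𝒪 : 𝔇.UnscaledOlder),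
      𝔇.UnscaledFieldLawOn χu χcu 𝒲 𝒪 γ ∧
      (∀ (Z : (domSys P M (k + 1)).Dom) (s : TermLabel P M k L), 𝔇.UnscaledBoxLaws χu χcu Z s) ∧
      (∀ (Z : (domSys P M (k + 1)).Dom) (s : TermLabel P M k L) (A : (𝔇.𝒦 Z s).Λ → ℝ), χu Z s A * χcu Z s A ≤ 1) ∧
      ∀ (Z : (domSys P M (k + 1)).Dom), 1 ≤ (Z.1).card → ∀ (s : TermLabel P M k L) (old : OlderTerms P 𝔸 M k) (φ : CPair P 𝔸) (t : ℝ), 0 < t →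
        ∃ ι : 𝔇.Inputs226Holo c Z s ((t : ℝ) : ℂ) old φ a 2, ∃ ag : 𝔇.AnalyticGrowthInputs χu 𝒲 𝒪 Z s old φ ι.Uτ,
        ∃ KE KG' KCs' θΓ' θC' θE' am wm δ : ℝ,
          0 ≤ KE ∧
          (∀ b b', ‖((𝔇.𝒦 Z s).C⁻¹.map (algebraMap ℝ ℂ)) b b'‖ ≤
            KE * Real.exp (-(ι.kap * tdist1 𝔇.Nf ((𝔇.𝒦 Z s).locΛ b) ((𝔇.𝒦 Z s).locΛ b')))) ∧
          (1 + (1 / 12 : ℝ)) * ι.KG ≤ KG' ∧ ((1 - (1 / 12 : ℝ)) ^ 2)⁻¹ * ι.KCs ≤ KCs' ∧ ι.θΓ + (1 / 12 : ℝ) * ι.KG ≤ θΓ' ∧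
          ι.θC + (1 / 12 : ℝ) * (2 + (1 / 12 : ℝ)) * ((1 - (1 / 12 : ℝ)) ^ 2)⁻¹ * ι.KCs ≤ θC' ∧ ι.θE + (1 / 12 : ℝ) * (2 + (1 / 12 : ℝ)) * (ι.θE + KE) ≤ θE' ∧
          θE' ≤ ι.θ ∧ θΓ' ≤ ι.θ ∧
          (((𝔇.𝒦 Z s).m * (1 + 2 / (ι.kap - ι.kap')) ^ 𝔇.ν) * ((𝔇.𝒦 Z s).m * (1 + 2 / (ι.kap' - ι.kap'')) ^ 𝔇.ν)
            * (θΓ' * KCs' * KG' + ι.KΓ * θC' * KG' + ι.KΓ * ι.K₀ * θΓ') ≤ ι.θ) ∧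
          (1 + (1 / 12 : ℝ)) ^ 2 * (2 * ag.ρ * (ag.Cp * B12TreeDecay.K₀ (4 * 2 ^ P.d) (2 * P.d))) ≤ am ∧ (1 + (1 / 12 : ℝ)) ^ 2 * (∑ Y ∈ s.1, ag.Rτ Y * (ag.M𝒪 Y + (2 * ag.M𝒪 Y / ag.R) * ag.ρ)) ≤ wm ∧
          0 < δ ∧ 2 * δ + 8 * ag.ρ * (ag.Cp * B12TreeDecay.K₀ (4 * 2 ^ P.d) (2 * P.d)) ≤ am ∧
          Real.exp (∑ Y ∈ s.1, ag.Rτ Y * ag.M𝒪 Y)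
              * ((∑ Y ∈ s.1, ag.Rτ Y * ((4 * (2 * ag.M𝒲 Y / ag.R ^ 4) + (4 * (ag.M𝒲 Y / ag.R ^ 3) + 4 * (ag.M𝒲 Y / ag.R ^ 3)) / ag.ρ) * (4 / (Real.exp 1 * δ)) ^ 4
                    + ((4 * ag.M𝒪 Y / ag.R ^ 2) + ((2 * ag.M𝒪 Y / ag.R) + (2 * ag.M𝒪 Y / ag.R)) / ag.ρ) * (2 / (Real.exp 1 * δ)) ^ 2)) * Real.exp (δ / 2)
                 + ((∑ Y ∈ s.1, ag.Rτ Y * (4 * (ag.M𝒲 Y / ag.R ^ 3) * (3 / (Real.exp 1 * δ)) ^ 3 + (2 * ag.M𝒪 Y / ag.R) * (1 / (Real.exp 1 * δ))))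
                      * Real.exp (δ / 2)) ^ 2
                    * Real.exp ((∑ Y ∈ s.1, ag.Rτ Y * (ag.M𝒪 Y + (2 * ag.M𝒪 Y / ag.R) * ag.ρ)) + ∑ Y ∈ s.1, ag.Rτ Y * ag.M𝒪 Y))
              ≤ Real.exp wm ∧
          (2 * (ι.θ * ((𝔇.𝒦 Z s).m * (1 + 2 / ι.kap'') ^ 𝔇.ν)) + (ι.γ₂ + am)) * ι.cE ≤ 1 / 2 ∧
          (2 * (ι.θ * ((𝔇.𝒦 Z s).m * (1 + 2 / ι.kap'') ^ 𝔇.ν)) + (ι.γ₂ + am)) * (1 + 2 * ι.cE * ι.g) ≤ 1 / 2 ∧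
          2 * (ι.K₀ * ((𝔇.𝒦 Z s).m * (1 + 2 / ι.kap) ^ 𝔇.ν) * (ι.θ * ((𝔇.𝒦 Z s).m * (1 + 2 / ι.kap'') ^ 𝔇.ν))
              * (1 + (1 - ι.K₀ * ((𝔇.𝒦 Z s).m * (1 + 2 / ι.kap) ^ 𝔇.ν) * (ι.θ * ((𝔇.𝒦 Z s).m * (1 + 2 / ι.kap'') ^ 𝔇.ν)))⁻¹) / 2)
              * (Fintype.card (𝔇.𝒦 Z s).Λ : ℝ)
            + wm + (2 * (ι.θ * ((𝔇.𝒦 Z s).m * (1 + 2 / ι.kap'') ^ 𝔇.ν)) + (ι.γ₂ + am)) * ι.cE * (Fintype.card (𝔇.𝒦 Z s).Λ : ℝ)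
            + (2 * (ι.θ * ((𝔇.𝒦 Z s).m * (1 + 2 / ι.kap'') ^ 𝔇.ν)) + (ι.γ₂ + am)) * (1 + 2 * ι.cE * ι.g)
              * (Fintype.card ((𝔇.𝒦 Z s).Λ ⊕ (𝔇.𝒦 Z s).C₀) : ℝ)
            ≤ 2 * ((Z.1).card : ℝ) ∧
          (s.2.card = 0 → ∃ κb Rb T : ℝ, 0 ≤ κb ∧ κb ≤ ι.γ₂ + am ∧
            (∀ B : (𝔇.𝒦 Z s).Λ → ℝ, B ⬝ᵥ B < Rb ^ 2 → χu Z s (t • B) * χcu Z s (t • B) = 1) ∧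
            Real.exp (-(κb / 2 * Rb ^ 2)) ≤ T * t ^ 2 ∧ 1 + T ≤ Mv) ∧
          (s.2.card ≠ 0 → ∃ r₁' T' : ℝ, r₁' ^ 2 ≤ ι.rP ^ 2 ∧ a ≤ ι.γ₂ * r₁' ^ 2 ∧
            Real.exp (-(ι.γ₂ / 2 * (ι.rP ^ 2 - r₁' ^ 2))) ≤ T' * t ^ 2 ∧ T' ≤ Mv) := by
  haveI hNe : ∀ i : Fin 0, NeZero ((![] : Fin 0 → ℕ) i) := fun i => i.elim0
  let z : UT (![] : Fin 0 → ℕ) := UT.ofSite (N := (![] : Fin 0 → ℕ)) fun i => i.elim0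
  -- W1-7's degenerate datum with INDICATOR boxes, kept OPAQUE (an equation `h𝔇`)
  obtain ⟨𝔇, h𝔇⟩ : ∃ 𝔇 : TermDatum214 c P 𝔸 M k L, 𝔇 =
      { ν := 0, Nf := ![], E₃ := ℂ,
        𝒦 := fun _ _ => freeKernels c ℂ Unit Empty (fun _ => z) (fun _ => z),
        finC₀ := fun _ _ => inferInstanceAs (Fintype Empty),
        decC₀ := fun _ _ => inferInstanceAs (DecidableEq Empty),
        uOf := fun _ _ _ => 0, r := 1,
        chiY₀ := fun _ t _ _ => if t.2.card = 0 then 1 else 0, chicP := fun _ _ _ _ => 1,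
        𝒱 := fun _ _ _ _ _ _ _ => 0 } := ⟨_, rfl⟩
  -- the datum's reductions
  have hA1 : ∀ (Z : (domSys P M (k + 1)).Dom) (s : TermLabel P M k L) (ψ : CPair P 𝔸) (σ : TPt P.d (domCount P M (k + 1)) → ℂ), 𝔇.A Z s ψ σ = 1 := by
    intro Z s ψ σ; subst h𝔇; rfl
  have hG0 : ∀ (Z : (domSys P M (k + 1)).Dom) (s : TermLabel P M k L) (σ : TPt P.d (domCount P M (k + 1)) → ℂ) (ψ : CPair P 𝔸),
      (𝔇.𝒦 Z s).G2 σ (𝔇.uOf Z s ψ) = 0 := by intro Z s σ ψ; subst h𝔇; rfl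
  have hΓ0 : ∀ (Z : (domSys P M (k + 1)).Dom) (s : TermLabel P M k L), (𝔇.𝒦 Z s).Γ₀ = 0 := by intro Z s; subst h𝔇; rfl
  have hC1 : ∀ (Z : (domSys P M (k + 1)).Dom) (s : TermLabel P M k L), (𝔇.𝒦 Z s).C = 1 := by intro Z s; subst h𝔇; rfl
  have hm : ∀ (Z : (domSys P M (k + 1)).Dom) (s : TermLabel P M k L), (𝔇.𝒦 Z s).m = 1 := by intro Z s; subst h𝔇; rfl
  have hpow : ∀ x : ℝ, x ^ 𝔇.ν = 1 := fun x => by subst h𝔇; exact pow_zero x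
  have hr1 : 𝔇.r = 1 := by subst h𝔇; rfl
  have hchi : ∀ (Z : (domSys P M (k + 1)).Dom) (s : TermLabel P M k L) (u : ℂ) (B : (𝔇.𝒦 Z s).Λ → ℝ),
      𝔇.chiY₀ Z s u B = if s.2.card = 0 then 1 else 0 := by intro Z s u B; subst h𝔇; rfl
  have hchic : ∀ (Z : (domSys P M (k + 1)).Dom) (s : TermLabel P M k L) (u : ℂ) (B : (𝔇.𝒦 Z s).Λ → ℝ), 𝔇.chicP Z s u B = 1 := by
    intro Z s u B; subst h𝔇; rfl
  have hV : ∀ (Z : (domSys P M (k + 1)).Dom) (s : TermLabel P M k L) (u : ℂ) (old : OlderTerms P 𝔸 M k) (φ : CPair P 𝔸)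
      (Y : TDom P.d (L * domCount P M (k + 1))) (B : (𝔇.𝒦 Z s).Λ → ℝ), 𝔇.𝒱 Z s u old φ Y B = 0 := by intro Z s u old φ Y B; subst h𝔇; rfl
  have hcardΛ : ∀ (Z : (domSys P M (k + 1)).Dom) (s : TermLabel P M k L), Fintype.card (𝔇.𝒦 Z s).Λ = 1 := by intro Z s; subst h𝔇; exact Fintype.card_unit
  have hcardΛC : ∀ (Z : (domSys P M (k + 1)).Dom) (s : TermLabel P M k L), Fintype.card ((𝔇.𝒦 Z s).Λ ⊕ (𝔇.𝒦 Z s).C₀) = 1 := by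
    intro Z s
    have h0 : Fintype.card (𝔇.𝒦 Z s).C₀ = 0 := Fintype.card_eq_zero_iff.2 ⟨fun x => by subst h𝔇; exact Empty.elim x⟩
    rw [Fintype.card_sum, hcardΛ, h0]
  -- W1-8's located τ-letters from the elementary conditions on `c`
  have hposY : ∀ Y : TDom P.d (L * domCount P M (k + 1)), 0 < invTau c ((tsys P.d (L * domCount P M (k + 1))).dj Y) := fun Y =>
    invTau_pos c hE hε hC₁ hα hMc _
  have hhalfY : ∀ Y : TDom P.d (L * domCount P M (k + 1)), invTau c ((tsys P.d (L * domCount P M (k + 1))).dj Y) ≤ 1 / 2 := by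
    intro Y
    have hd : 0 ≤ (tsys P.d (L * domCount P M (k + 1))).dj Y := torusTreeLen_nonneg Y.1
    have hpref0 : 0 ≤ c.E₀ * c.ε₁ * c.C₁ * c.α₄⁻¹ * c.M ^ c.q * Real.exp (c.C₂ * c.κ₁) := by positivity
    unfold invTau
    calc c.E₀ * c.ε₁ * c.C₁ * c.α₄⁻¹ * c.M ^ c.q * Real.exp (c.C₂ * c.κ₁) * Real.exp (-(1 - 3 * c.δ) * c.κ * (tsys P.d (L * domCount P M (k + 1))).dj Y)
        ≤ c.E₀ * c.ε₁ * c.C₁ * c.α₄⁻¹ * c.M ^ c.q * Real.exp (c.C₂ * c.κ₁) * 1 := by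
          refine mul_le_mul_of_nonneg_left (Real.exp_le_one_iff.2 ?_) hpref0
          have : 0 ≤ (1 - 3 * c.δ) * c.κ * (tsys P.d (L * domCount P M (k + 1))).dj Y := mul_nonneg hδκ hd
          linarith
      _ ≤ 1 / 2 := by rw [mul_one]; exact hpref
  have hMv0 : 0 < Mv := zero_lt_one.trans hMv
  -- the unscaled readings: indicator boxes, zero potentials
  refine ⟨𝔇, fun _ s _ => if s.2.card = 0 then 1 else 0, fun _ _ _ => 1, fun _ _ _ _ _ => 0, fun _ _ _ _ _ _ => 0, ?_, ?_, ?_, ?_⟩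
  · -- hlaw: the datum's boxes ∕ potentials at every real coupling ARE the unscaled readings (all are coupling- and field-free)
    intro Z s u _
    refine ⟨fun B => hchi Z s _ B, fun B => hchic Z s _ B, fun old φ Y B => ?_⟩
    rw [hV, mul_zero, add_zero]
  · -- hBox: nonnegative, even, measurable
    intro Z s
    exact { hχ0 := fun _ => by split_ifs <;> norm_num, hχc0 := fun _ => zero_le_one, hχe := fun _ => rfl, hχce := fun _ => rfl,
            hχm := measurable_const, hχcm := measurable_const }
  · -- hχ1
    intro Z s A
    show (if s.2.card = 0 then (1 : ℝ) else 0) * 1 ≤ 1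
    split_ifs <;> norm_num
  -- the located family, per slice and base point
  intro Z hZ s old φ t ht
  set y : ℝ := max 0 (-Real.log (Mv * t ^ 2)) with hy
  have hy0 : 0 ≤ y := le_max_left _ _
  have hrate : Real.exp (-y) ≤ Mv * t ^ 2 := exp_neg_posLog_le (by positivity)
  set y' : ℝ := max 0 (-Real.log ((Mv - 1) * t ^ 2)) with hy'
  have hy'0 : 0 ≤ y' := le_max_left _ _
  have hrate' : Real.exp (-y') ≤ (Mv - 1) * t ^ 2 := exp_neg_posLog_le (mul_pos (by linarith) (by positivity))
  set r₁ : ℝ := Real.sqrt (20 * max a 0) with hr₁def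
  set rP : ℝ := Real.sqrt (20 * max a 0 + 40 * y) with hrPdef
  have hr₁sq : r₁ ^ 2 = 20 * max a 0 := Real.sq_sqrt (by positivity)
  have hrPsq : rP ^ 2 = 20 * max a 0 + 40 * y := Real.sq_sqrt (by positivity)
  -- the `Inputs226Holo` record (J10-W's letters), kept OPAQUE with its projections recorded
  obtain ⟨ι, hι⟩ : ∃ ι : 𝔇.Inputs226Holo c Z s ((t : ℝ) : ℂ) old φ a 2, ι =
    { Uσ := univ
      Uτ := fun Y => ball 0 ((invTau c ((tsys P.d (L * domCount P M (k + 1))).dj Y))⁻¹ + 3)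
      γ₂ := 1 / 20, rP := rP, a₂₀ := 0, w := 0, qP := fun B => B ⬝ᵥ B, kap := 3, kap' := 2, kap'' := 1, θ := 1 / 5,
      θE := 0, θΓ := 0, θC := 0, KG := 0, KΓ := 0, KCs := 1, K₀ := 1, cE := 1, g := 0,
      hpos := hposY, hhalf := hhalfY,
      hUσ := isOpen_univ, hUτ := fun _ => isOpen_ball, hUexp := subset_univ _,
      hUtau := fun Y => closedBall_subset_ball (by linarith),
      hr := by rw [hr1]; exact zero_lt_one,
      hr' := by rw [hr1]; linarith [Real.add_one_le_exp c.κ₁],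
      hsubτ := by
        intro Y x hx w hw
        rw [Set.uIcc_of_le zero_le_one] at hx
        rw [mem_closedBall, hr1] at hw
        rw [mem_ball, dist_zero_right]
        have hx1 : ‖(x : ℂ)‖ ≤ 1 := by rw [Complex.norm_real, Real.norm_eq_abs]; exact abs_le.2 ⟨by linarith [hx.1], hx.2⟩
        have hinv : 0 < (invTau c ((tsys P.d (L * domCount P M (k + 1))).dj Y))⁻¹ := inv_pos.2 (hposY Y)
        calc ‖w‖ = ‖(w - (x : ℂ)) + (x : ℂ)‖ := by rw [sub_add_cancel]
          _ ≤ ‖w - (x : ℂ)‖ + ‖(x : ℂ)‖ := norm_add_le _ _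
          _ ≤ 1 + 1 := add_le_add (by rw [← dist_eq_norm]; exact hw) hx1
          _ < (invTau c ((tsys P.d (L * domCount P M (k + 1))).dj Y))⁻¹ + 3 := by linarith,
      hχ0 := fun B => by rw [hchi]; split_ifs <;> norm_num,
      hχc0 := fun B => by rw [hchic]; exact zero_le_one,
      hAhol := fun i j => by simp only [hA1]; exact differentiableOn_const _,
      hGhol := fun i j => by simp only [hG0]; exact differentiableOn_const _,
      hχm := by rw [show 𝔇.chiY₀ Z s ((t : ℝ) : ℂ) = fun _ => (if s.2.card = 0 then (1 : ℝ) else 0) from funext fun B => hchi Z s _ B]; exact measurable_const,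
      hχcm := by rw [show 𝔇.chicP Z s ((t : ℝ) : ℂ) = fun _ => (1 : ℝ) from funext fun B => hchic Z s _ B]; exact measurable_const,
      hVm := fun Y => by rw [show 𝔇.𝒱 Z s ((t : ℝ) : ℂ) old φ Y = fun _ => (0 : ℂ) from funext fun B => hV Z s _ old φ Y B]; exact measurable_const,
      hAs := fun σ _ => by rw [hA1]; exact Matrix.isSymm_one,
      hA := fun σ _ => by rw [hA1, Matrix.map_one _ Complex.zero_re Complex.one_re]; exact Matrix.PosDef.one,
      h222 := fun B => by
        have hB : 0 ≤ B ⬝ᵥ B := Finset.sum_nonneg fun i _ => mul_self_nonneg (B i)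
        rw [hchi, hchic, mul_one]
        split_ifs with h
        · rw [h]; simp only [Nat.cast_zero, mul_zero, neg_zero, zero_add]; exact Real.one_le_exp (by positivity)
        · exact (Real.exp_pos _).le,
      hγ₂ := by norm_num, hqP := fun _ => le_rfl,
      h220U := fun τ _ B => by
        rw [Finset.sum_eq_zero fun Y _ => by rw [hV, norm_zero, mul_zero]]
        have hB : 0 ≤ B ⬝ᵥ B := Finset.sum_nonneg fun i _ => mul_self_nonneg (B i)
        positivity,
      ha0 := le_rfl,
      hfibN := fun x => (Finset.card_filter_le _ _).trans (by rw [Finset.card_univ, hcardΛC, hm]),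
      hkap'' := by norm_num, h1 := by norm_num, h2 := by norm_num,
      hθE := le_rfl, hθΓ := le_rfl, hθC := le_rfl, hKG := le_rfl, hKΓ := le_rfl, hKCs := zero_le_one, hK₀ := zero_le_one,
      hθEle := by norm_num, hθΓle := by norm_num,
      hθR1le := by simp only [hpow, hm, Nat.cast_one, mul_one]; norm_num,
      hG := fun σ _ b j => by rw [hG0, Matrix.zero_apply, norm_zero, zero_mul],
      hΓ₀ := fun b j => by rw [hΓ0, Matrix.zero_apply, norm_zero, zero_mul],
      hCs := fun σ _ b b' => by
        rw [hA1, inv_one]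
        by_cases hb : b = b'
        · subst hb; rw [Matrix.one_apply_eq, norm_one, tdist1_self, mul_zero, neg_zero, Real.exp_zero, mul_one]
        · rw [Matrix.one_apply_ne hb, norm_zero]; positivity,
      hC216 := fun b b' => by
        rw [hC1]
        by_cases hb : b = b'
        · subst hb; rw [Matrix.one_apply_eq, norm_one, tdist1_self, mul_zero, neg_zero, Real.exp_zero, mul_one]
        · rw [Matrix.one_apply_ne hb, norm_zero]; positivity,
      hdΓ := fun σ _ b j => by rw [hG0, hΓ0, Matrix.map_zero _ (map_zero _), sub_zero, Matrix.zero_apply, norm_zero, zero_mul],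
      hdC := fun σ _ b b' => by rw [hA1, hC1, inv_one, Matrix.map_one _ (map_zero _) (map_one _), sub_self, Matrix.zero_apply, norm_zero, zero_mul],
      hdE := fun σ _ b b' => by rw [hA1, hC1, inv_one, Matrix.map_one _ (map_zero _) (map_one _), sub_self, Matrix.zero_apply, norm_zero, zero_mul],
      hsmallKθ := by simp only [hpow, hm, Nat.cast_one, mul_one]; norm_num,
      hc0 := zero_le_one,
      hc := fun i => by
        haveI : Nonempty (𝔇.𝒦 Z s).Λ := ⟨i⟩
        have h : (𝔇.𝒦 Z s).hC.1.eigenvalues i ∈ spectrum ℝ (1 : Matrix (𝔇.𝒦 Z s).Λ (𝔇.𝒦 Z s).Λ ℝ) := by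
          have h0 := (𝔇.𝒦 Z s).hC.1.eigenvalues_mem_spectrum_real i
          rwa [show spectrum ℝ (𝔇.𝒦 Z s).C = spectrum ℝ (1 : Matrix (𝔇.𝒦 Z s).Λ (𝔇.𝒦 Z s).Λ ℝ) by rw [hC1]] at h0
        rw [spectrum.one_eq, Set.mem_singleton_iff] at h
        exact h.le,
      hαc := by simp only [hpow, hm, Nat.cast_one, mul_one]; norm_num,
      hg := le_rfl,
      hΓq := fun X => by rw [hΓ0, Matrix.zero_mulVec, zero_dotProduct, zero_mul],
      hsmall := by simp only [hpow, hm, Nat.cast_one, mul_one]; norm_num,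
      hPa := by rw [hrPsq]; nlinarith [le_max_left a 0, le_max_right a 0, hy0],
      hvol := by
        have h1 : (1 : ℝ) ≤ ((Z.1).card : ℝ) := Nat.one_le_cast.mpr hZ
        simp only [hpow, hm, hcardΛ, hcardΛC, Nat.cast_one, mul_one, one_mul]
        nlinarith [h1] } := ⟨_, rfl⟩
  have eUτ : ι.Uτ = fun Y => ball 0 ((invTau c ((tsys P.d (L * domCount P M (k + 1))).dj Y))⁻¹ + 3) := by subst hι; rfl
  have eγ₂ : ι.γ₂ = 1 / 20 := by simp only [hι]
  have erP : ι.rP = rP := by simp only [hι]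
  have ekap : ι.kap = 3 := (by simp only [hι]); have ekap'' : ι.kap'' = 1 := by simp only [hι]
  have eθ : ι.θ = 1 / 5 := by simp only [hι]
  have eθE : ι.θE = 0 := (by simp only [hι]); have eθΓ : ι.θΓ = 0 := (by simp only [hι]); have eθC : ι.θC = 0 := by simp only [hι]
  have eKG : ι.KG = 0 := (by simp only [hι]); have eKΓ : ι.KΓ = 0 := (by simp only [hι]); have eKCs : ι.KCs = 1 := by simp only [hι]
  have eK₀ : ι.K₀ = 1 := (by simp only [hι]); have ecE : ι.cE = 1 := (by simp only [hι]); have eg : ι.g = 0 := by simp only [hι]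
  -- LEMMA 2's sentence with located data at the ZERO complex potentials (W1-12b), kept OPAQUE with its projections recorded
  obtain ⟨ag, hag⟩ : ∃ ag : 𝔇.AnalyticGrowthInputs (fun _ s _ => if s.2.card = 0 then 1 else 0) (fun _ _ _ _ _ => 0) (fun _ _ _ _ _ _ => 0) Z s old φ ι.Uτ, ag =
    { Wc := fun _ _ => 0, Oc := fun _ _ => 0, R := 2, hR := two_pos, M𝒲 := fun _ => 0, M𝒪 := fun _ => 0,
      h𝒲re := fun _ _ => rfl, h𝒪re := fun _ _ => rfl,
      hWd := fun _ => differentiableOn_const _, hWM := fun _ _ _ => by rw [norm_zero],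
      hWB := fun _ w => ⟨0, Filter.Eventually.of_forall fun u => by show ‖(0 : ℂ)‖ ≤ 0 * ‖u‖ ^ 3; rw [norm_zero, zero_mul]⟩,
      hOd := fun _ => differentiableOn_const _, hOM := fun _ _ _ => by rw [norm_zero],
      S := fun _ => ∅, hloc𝒲 := fun _ _ _ _ => rfl, hloc𝒪 := fun _ _ _ _ => rfl,
      ρ := 1, hρ := zero_lt_one, hρR := by norm_num,
      h𝒲m := fun _ => measurable_const, h𝒪m := fun _ => measurable_const,
      Rτ := fun Y => (invTau c ((tsys P.d (L * domCount P M (k + 1))).dj Y))⁻¹ + 3,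
      hRτ := fun Y _ => by have := inv_pos.2 (hposY Y); linarith,
      hUτR := fun Y _ w hw => by rw [eUτ, mem_ball, dist_zero_right] at hw; exact hw.le,
      cubeOf := fun _ => 0,
      hS := fun _ _ b hb => absurd hb (Finset.notMem_empty _),
      Cp := 0, κp := B12TreeDecay.kappa₀ (4 * 2 ^ P.d) (2 * P.d), hCp := le_rfl, hκp := le_rfl,
      hdecay := fun _ _ => by rw [zero_div, mul_zero, zero_mul],
      S₀ := ∅,
      hSS₀ := fun _ _ b hb => absurd hb (Finset.notMem_empty _),
      hbox := fun _ _ b hb => absurd hb (Set.notMem_empty _) } := ⟨_, rfl⟩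
  have eρ : ag.ρ = 1 := by simp only [hag]
  have eCp : ag.Cp = 0 := by simp only [hag]
  have eM𝒲 : ag.M𝒲 = fun _ => 0 := by simp only [hag]
  have eM𝒪 : ag.M𝒪 = fun _ => 0 := by simp only [hag]
  have h1Z : (1 : ℝ) ≤ ((Z.1).card : ℝ) := Nat.one_le_cast.mpr hZ
  -- the record equations are no longer needed (and must not burden the arithmetic closers)
  clear hag hι h𝔇
  refine ⟨ι, ag, 1, 0, ((1 - (1 / 12 : ℝ)) ^ 2)⁻¹, 0, (1 / 12 : ℝ) * (2 + (1 / 12 : ℝ)) * ((1 - (1 / 12 : ℝ)) ^ 2)⁻¹ * 1, (1 / 12 : ℝ) * (2 + (1 / 12 : ℝ)), 1 / 20, 0, 1 / 40,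
    zero_le_one, ?_, ?_, ?_, ?_, ?_, ?_, ?_, ?_, ?_, ?_, ?_, ?_, ?_, ?_, ?_, ?_, ?_, ?_, ?_⟩
  · -- (r1) the entrywise decay of C⁻¹ = 1
    intro b b'
    rw [hC1, inv_one, Matrix.map_one _ (map_zero _) (map_one _)]
    by_cases hb : b = b'
    · subst hb; rw [Matrix.one_apply_eq, norm_one, tdist1_self, mul_zero, neg_zero, Real.exp_zero, mul_one]
    · rw [Matrix.one_apply_ne hb, norm_zero]; positivity
  · rw [eKG]; norm_num
  · rw [eKCs, mul_one]
  · rw [eθΓ, eKG]; norm_num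
  · rw [eθC, eKCs, zero_add]
  · rw [eθE]; norm_num
  · rw [eθ]; norm_num
  · rw [eθ]; norm_num
  · simp only [hpow, eKΓ, eK₀, eθ, hm, Nat.cast_one, mul_one]; norm_num
  · rw [eρ, eCp]; norm_num
  · rw [eM𝒪]; simp
  · norm_num
  · rw [eρ, eCp]; norm_num
  · rw [eM𝒪, eM𝒲, eρ]; simp
  · simp only [eθ, hpow, eγ₂, ecE, hm, Nat.cast_one, mul_one]; norm_num
  · simp only [eθ, hpow, eγ₂, ecE, eg, hm, Nat.cast_one, mul_one]; norm_num
  · simp only [eK₀, eθ, hpow, eγ₂, ecE, eg, hm, hcardΛ, hcardΛC, Nat.cast_one, mul_one, one_mul]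
    nlinarith [h1Z]
  · -- (r5) on |P(s)| = 0: the boxes ARE 1; rate e^{−log⁺(1∕((Mv−1)t²))} ≤ (Mv − 1)t²
    intro hP
    refine ⟨1 / 20, Real.sqrt (40 * y'), Mv - 1, by norm_num, by rw [eγ₂]; norm_num, fun B _ => ?_, ?_, by linarith⟩
    · show (if s.2.card = 0 then (1 : ℝ) else 0) * 1 = 1
      rw [if_pos hP, one_mul]
    · rw [Real.sq_sqrt (by positivity)]
      have : -(1 / 20 / 2 * (40 * y')) = -y' := by ring
      rw [this]
      exact hrate'
  · -- (r6) on |P(s)| ≠ 0: J10-W's surplus radii; rate e^{−log⁺(1∕(Mv t²))} ≤ Mv t²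
    intro _
    have hPa1 : a ≤ ι.γ₂ * r₁ ^ 2 := by
      rw [eγ₂, hr₁sq]
      have ha0 := le_max_left a 0
      linarith
    refine ⟨r₁, Mv, by rw [erP, hr₁sq, hrPsq]; linarith, hPa1, ?_, le_rfl⟩
    rw [eγ₂, erP, hrPsq, hr₁sq]
    have : -(1 / 20 / 2 * (20 * max a 0 + 40 * y - 20 * max a 0)) = -y := by ring
    rw [this]
    exact hrate


/-! ## §2 ★ The same for J88 ∕ J81r's family (W1-12's `LocalGrowthInputs`) — `lg := LocalGrowthInputs.ofAnalytic ag`, rows by `rfl` -/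

open Classical in
/-- ★ **THE LOCATED FAMILY OF J88 ∕ J81r (`lg : LocalGrowthInputs`) IS INHABITED JOINTLY WITH `hlaw`, `hBox`, `hχ1`** — §1 read through node00-def-W1's constructor
`LocalGrowthInputs.ofAnalytic` (W1-12b): every (r3) row in the derived record's letters `ρ, m₃, R, c₀ … c₄` IS the corresponding row of §1 in Lemma 2's letters by `rfl`
(`ofAnalytic_ρ ∕ _m₃ ∕ _R ∕ _c₀ ∕ …`); statement = J88's `hιc` body VERBATIM at `ρ_b = 1∕12`, `a₅ = 2`.  A6 witness at degenerate data; nothing of print's.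
[cite: Balaban1988RG2Cluster, (2.3) p.12, (2.14) p.15 and (2.22) p.16 (degenerate data; bookkeeping)] -/
theorem locatedRecords_inhabited (hκ₁ : 1 ≤ c.κ₁) (hE : 0 < c.E₀) (hε : 0 < c.ε₁) (hC₁ : 0 < c.C₁) (hα : 0 < c.α₄) (hMc : 0 < c.M)
    (hδκ : 0 ≤ (1 - 3 * c.δ) * c.κ) (hpref : c.E₀ * c.ε₁ * c.C₁ * c.α₄⁻¹ * c.M ^ c.q * Real.exp (c.C₂ * c.κ₁) ≤ 1 / 2)
    (γ a : ℝ) {Mv : ℝ} (hMv : 1 < Mv) :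
    ∃ (𝔇 : TermDatum214 c P 𝔸 M k L) (χu χcu : 𝔇.UnscaledChi) (𝒲 : 𝔇.UnscaledWilson) (𝒪 : 𝔇.UnscaledOlder),
      𝔇.UnscaledFieldLawOn χu χcu 𝒲 𝒪 γ ∧
      (∀ (Z : (domSys P M (k + 1)).Dom) (s : TermLabel P M k L), 𝔇.UnscaledBoxLaws χu χcu Z s) ∧
      (∀ (Z : (domSys P M (k + 1)).Dom) (s : TermLabel P M k L) (A : (𝔇.𝒦 Z s).Λ → ℝ), χu Z s A * χcu Z s A ≤ 1) ∧
      ∀ (Z : (domSys P M (k + 1)).Dom), 1 ≤ (Z.1).card → ∀ (s : TermLabel P M k L) (old : OlderTerms P 𝔸 M k) (φ : CPair P 𝔸) (t : ℝ), 0 < t →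
        ∃ ι : 𝔇.Inputs226Holo c Z s ((t : ℝ) : ℂ) old φ a 2, ∃ lg : 𝔇.LocalGrowthInputs χu 𝒲 𝒪 Z s old φ ι.Uτ,
        ∃ KE KG' KCs' θΓ' θC' θE' am wm δ : ℝ,
          0 ≤ KE ∧
          (∀ b b', ‖((𝔇.𝒦 Z s).C⁻¹.map (algebraMap ℝ ℂ)) b b'‖ ≤
            KE * Real.exp (-(ι.kap * tdist1 𝔇.Nf ((𝔇.𝒦 Z s).locΛ b) ((𝔇.𝒦 Z s).locΛ b')))) ∧
          (1 + (1 / 12 : ℝ)) * ι.KG ≤ KG' ∧ ((1 - (1 / 12 : ℝ)) ^ 2)⁻¹ * ι.KCs ≤ KCs' ∧ ι.θΓ + (1 / 12 : ℝ) * ι.KG ≤ θΓ' ∧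
          ι.θC + (1 / 12 : ℝ) * (2 + (1 / 12 : ℝ)) * ((1 - (1 / 12 : ℝ)) ^ 2)⁻¹ * ι.KCs ≤ θC' ∧ ι.θE + (1 / 12 : ℝ) * (2 + (1 / 12 : ℝ)) * (ι.θE + KE) ≤ θE' ∧
          θE' ≤ ι.θ ∧ θΓ' ≤ ι.θ ∧
          (((𝔇.𝒦 Z s).m * (1 + 2 / (ι.kap - ι.kap')) ^ 𝔇.ν) * ((𝔇.𝒦 Z s).m * (1 + 2 / (ι.kap' - ι.kap'')) ^ 𝔇.ν)
            * (θΓ' * KCs' * KG' + ι.KΓ * θC' * KG' + ι.KΓ * ι.K₀ * θΓ') ≤ ι.θ) ∧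
          (1 + (1 / 12 : ℝ)) ^ 2 * (2 * lg.ρ * lg.m₃) ≤ am ∧ (1 + (1 / 12 : ℝ)) ^ 2 * (∑ Y ∈ s.1, lg.R Y * (lg.c₀ Y + lg.c₁ Y * lg.ρ)) ≤ wm ∧
          0 < δ ∧ 2 * δ + 8 * lg.ρ * lg.m₃ ≤ am ∧
          Real.exp (∑ Y ∈ s.1, lg.R Y * lg.c₀ Y)
              * ((∑ Y ∈ s.1, lg.R Y * ((4 * lg.c₄ Y + (4 * lg.c₃ Y + 4 * lg.c₃' Y) / lg.ρ) * (4 / (Real.exp 1 * δ)) ^ 4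
                    + (lg.c₂ Y + (lg.c₁ Y + lg.c₁' Y) / lg.ρ) * (2 / (Real.exp 1 * δ)) ^ 2)) * Real.exp (δ / 2)
                 + ((∑ Y ∈ s.1, lg.R Y * (4 * lg.c₃ Y * (3 / (Real.exp 1 * δ)) ^ 3 + lg.c₁ Y * (1 / (Real.exp 1 * δ))))
                      * Real.exp (δ / 2)) ^ 2
                    * Real.exp ((∑ Y ∈ s.1, lg.R Y * (lg.c₀ Y + lg.c₁ Y * lg.ρ)) + ∑ Y ∈ s.1, lg.R Y * lg.c₀ Y))
              ≤ Real.exp wm ∧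
          (2 * (ι.θ * ((𝔇.𝒦 Z s).m * (1 + 2 / ι.kap'') ^ 𝔇.ν)) + (ι.γ₂ + am)) * ι.cE ≤ 1 / 2 ∧
          (2 * (ι.θ * ((𝔇.𝒦 Z s).m * (1 + 2 / ι.kap'') ^ 𝔇.ν)) + (ι.γ₂ + am)) * (1 + 2 * ι.cE * ι.g) ≤ 1 / 2 ∧
          2 * (ι.K₀ * ((𝔇.𝒦 Z s).m * (1 + 2 / ι.kap) ^ 𝔇.ν) * (ι.θ * ((𝔇.𝒦 Z s).m * (1 + 2 / ι.kap'') ^ 𝔇.ν))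
              * (1 + (1 - ι.K₀ * ((𝔇.𝒦 Z s).m * (1 + 2 / ι.kap) ^ 𝔇.ν) * (ι.θ * ((𝔇.𝒦 Z s).m * (1 + 2 / ι.kap'') ^ 𝔇.ν)))⁻¹) / 2)
              * (Fintype.card (𝔇.𝒦 Z s).Λ : ℝ)
            + wm + (2 * (ι.θ * ((𝔇.𝒦 Z s).m * (1 + 2 / ι.kap'') ^ 𝔇.ν)) + (ι.γ₂ + am)) * ι.cE * (Fintype.card (𝔇.𝒦 Z s).Λ : ℝ)
            + (2 * (ι.θ * ((𝔇.𝒦 Z s).m * (1 + 2 / ι.kap'') ^ 𝔇.ν)) + (ι.γ₂ + am)) * (1 + 2 * ι.cE * ι.g)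
              * (Fintype.card ((𝔇.𝒦 Z s).Λ ⊕ (𝔇.𝒦 Z s).C₀) : ℝ)
            ≤ 2 * ((Z.1).card : ℝ) ∧
          (s.2.card = 0 → ∃ κb Rb T : ℝ, 0 ≤ κb ∧ κb ≤ ι.γ₂ + am ∧
            (∀ B : (𝔇.𝒦 Z s).Λ → ℝ, B ⬝ᵥ B < Rb ^ 2 → χu Z s (t • B) * χcu Z s (t • B) = 1) ∧
            Real.exp (-(κb / 2 * Rb ^ 2)) ≤ T * t ^ 2 ∧ 1 + T ≤ Mv) ∧
          (s.2.card ≠ 0 → ∃ r₁' T' : ℝ, r₁' ^ 2 ≤ ι.rP ^ 2 ∧ a ≤ ι.γ₂ * r₁' ^ 2 ∧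
            Real.exp (-(ι.γ₂ / 2 * (ι.rP ^ 2 - r₁' ^ 2))) ≤ T' * t ^ 2 ∧ T' ≤ Mv) := by
  obtain ⟨𝔇, χu, χcu, 𝒲, 𝒪, hlaw, hBox, hχ1, hfam⟩ := locatedLemma2Records_inhabited c P 𝔸 M k L hκ₁ hE hε hC₁ hα hMc hδκ hpref γ a hMv
  refine ⟨𝔇, χu, χcu, 𝒲, 𝒪, hlaw, hBox, hχ1, fun Z hZ s old φ t ht => ?_⟩
  obtain ⟨ι, ag, KE, KG', KCs', θΓ', θC', θE', am, wm, δ, h₁, h₂, h₃, h₄, h₅, h₆, h₇, h₈, h₉, h₁₀, h₁₁, h₁₂, h₁₃, h₁₄, h₁₅, h₁₆, h₁₇, h₁₈, h₁₉, h₂₀⟩ :=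
    hfam Z hZ s old φ t ht
  exact ⟨ι, TermDatum214.LocalGrowthInputs.ofAnalytic ag, KE, KG', KCs', θΓ', θC', θE', am, wm, δ, h₁, h₂, h₃, h₄, h₅, h₆, h₇, h₈, h₉, h₁₀, h₁₁, h₁₂, h₁₃, h₁₄, h₁₅,
    h₁₆, h₁₇, h₁₈, h₁₉, h₂₀⟩

end YMDAG.N22.W1

end
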